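import Literature.NumberTheory.Automorphic.EichlerEmbeddingLocalLevel
import HarnessLib

/-!
# k3 · generation 8 sketch for `stub_takahashi` (crux `stmt-ABC-11338`, `DefiniteRTControlPrime`, route `DefiniteXi`)

FAMILY 3 (probe the extremes), two techniques deep, applied to the node of the k3 depth path that gens 6–7
flagged as the HARDEST stub of Plan A: **H6.A4** = Voight, *Quaternion algebras*, Lemma 30.6.9 (b)(c)
(`ϖ⁻¹ N_x ϖ ~ N_{x'}` iff `x' ≡ t − x (mod q^e)` and (`d` unit or `f(x) ≢ 0 (mod q^{e+1})`), "direction (c) ⇒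
is the subtle one"), together with its sibling **H6.A3** = L. 30.6.9 (a).

* T1 **extremal configuration.**  The Eichler order of level `q^e` is `O = O₀ ∩ O_e`, the two END vertices of
  its path of maximal orders (`O₀ = M₂(ℤ_q)`, `O_e = ϖ⁻¹ O₀ ϖ`), and `O^× ⊆ GL₂(ℤ_q) = O₀^×`.  Hence
  "`A` is optimal for `O₀`" — i.e. `A ≢ λ·1 (mod q M₂(ℤ_q))`, `¬ IsScalarModQ A` below — is invariant under
  conjugation by ANY `μ ∈ GL₂(ℤ_q)` (one line: `μ⁻¹(λ + qX)μ = λ + q μ⁻¹Xμ`).  A normalized matrix `N_x` has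
  entry `1`, so it is never scalar mod `q`; its `ϖ`-conjugate `(t−x, −f(x)/q^e; q^e, x)` (30.6.10) IS scalar
  mod `q` exactly when `q ∣ t − 2x` (automatic when `q ∣ d`, as `(t−2x)² = d + 4 f(x)`) and `q^{e+1} ∣ f(x)`.
  That is the whole of (c) ⇒.  (b) and (c) ⇐ are two explicit conjugations (`diag(1, β⁻¹)`, resp.
  `(1 u; 0 1)` then a diagonal), landing on `N_{t−x}` resp. `N_{t−x−u q^e}`; (a) ⇒ is the same move one
  level down: the diagonal entries are class functions modulo `q^e` (H8.10).  H6.A3 + H6.A4 drop from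
  `S–M` + `M` to ten `S/XS` lemmas with explicit witnesses; the assembly of both `iff`s is kernel-checked
  below modulo those lemmas.
* T2 **certified small cases / degenerate parameters.**  (i) An EXACT decision procedure for `O^×`-conjugacy
  over `ℤ_q` of integer matrices (rank-2 intertwiner lattice, `q`-saturated, `det mod q`;
  `scratch/voight_3069_exact.py`) certifies L. 30.6.9 (a)(b)(c), Prop. 30.6.12's count, L. 30.6.3 on
  integer samples and the T1 invariant for `(q,e) ∈ {(2,1…8), (3,1…3), (5,1…2), (7,1), (11,1)}`: 13 670
  `(t,n)` cases, 0 failures, 704 of them with new `ϖ`-classes, 267 585 normal-form samples (the crux only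
  ever needs `q = 2, e ≤ 8`: Frey cofactors, `N ∣ 2⁸·rad`).  (ii) AUTOPSY of the obvious finite proxy:
  orbits of `(O/q^m)^×` on `{tr ≡ t, det ≡ n}` OVER-count (residues need not lift to char. poly. `f`:
  `q=3, e=1, f=X²−6X`: 4 orbits mod 9 vs 2 classes) — so a future `decide` certificate must quantify over
  normal forms, not over residues.  (iii) `e = 0` makes H6.A4 false as typed (ϖ ∈ O^×): `he : 1 ≤ e` is
  load-bearing; `d = 0` (non-reduced `f`) is harmless (no lemma below uses `d ≠ 0`).

Definitions `eichlerSet / IsOptimalMat / EichConj / normMat / varpi` are copied VERBATIM from gen 6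
(`StubIdeas3g6Sketch.lean`); new: `varpiConj` (30.6.10) and `IsScalarModQ`.
Source pages: [corpus: paper:url-ec4e7f04c233 p.542–544 = Voight §30.6, L. 30.6.3, Def. 30.6.8, L. 30.6.9,
(30.6.10)–(30.6.11), Prop. 30.6.12] ← Hijikata 1974 Thm. 2.3.
-/

noncomputable section

open scoped Matrix
open Literature.NumberTheory.Automorphic

set_option linter.unusedVariables false
set_option linter.dupNamespace false

namespace Summit.ABC.ABC.Cruxes.DefiniteRTControlPrime.StubIdeas3g8

/-! ## Definitions (verbatim from gen 6, plus (30.6.10) and the mod-`q` scalar predicate) -/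

section Defs

variable {q : ℕ} [hq : Fact q.Prime]

/-- The standard local Eichler order of level `q^e`, `(ℤ_q ℤ_q; q^e ℤ_q ℤ_q)`, as a set of matrices. -/
def eichlerSet (q : ℕ) [Fact q.Prime] (e : ℕ) : Set (Matrix (Fin 2) (Fin 2) ℚ_[q]) :=
  {A | (∀ i j, ‖A i j‖ ≤ 1) ∧ ‖A 1 0‖ ≤ (q : ℝ) ^ (-(e : ℤ))}

/-- `A ∈ O` generates an OPTIMALLY embedded order `ℤ_q[A]`: "at least one of `b`, `c/q^e`, `a - d` is a unit". -/
def IsOptimalMat (q : ℕ) [Fact q.Prime] (e : ℕ) (A : Matrix (Fin 2) (Fin 2) ℚ_[q]) : Prop :=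
  A ∈ eichlerSet q e ∧
    ¬ (‖A 0 1‖ < 1 ∧ ‖A 0 0 - A 1 1‖ < 1 ∧ ‖A 1 0‖ ≤ (q : ℝ) ^ (-((e + 1 : ℕ) : ℤ)))

/-- Conjugacy under the unit group of the standard Eichler order: `A' = μ⁻¹ A μ`, `μ ∈ O^×`. -/
def EichConj (q : ℕ) [Fact q.Prime] (e : ℕ) (A A' : Matrix (Fin 2) (Fin 2) ℚ_[q]) : Prop :=
  ∃ μ : Matrix (Fin 2) (Fin 2) ℚ_[q], μ ∈ eichlerSet q e ∧ IsUnit μ.det ∧ μ⁻¹ ∈ eichlerSet q e ∧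
    A' = μ⁻¹ * A * μ

/-- Voight's normalized matrix `N_x = (x 1; -f(x) t-x)`, `f = X² - tX + n` (Def. 30.6.8). -/
def normMat (t n x : ℚ_[q]) : Matrix (Fin 2) (Fin 2) ℚ_[q] := !![x, 1; -(x ^ 2 - t * x + n), t - x]

/-- The Atkin–Lehner element `ϖ = (0 1; q^e 0)` of the normalizer (30.6.1). -/
def varpi (q : ℕ) [Fact q.Prime] (e : ℕ) : Matrix (Fin 2) (Fin 2) ℚ_[q] := !![0, 1; (q : ℚ_[q]) ^ e, 0]

/-- NEW (30.6.10): the `ϖ`-conjugate of the normalized matrix, `ϖ⁻¹ N_x ϖ = (t-x, -f(x)/q^e; q^e, x)`. -/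
def varpiConj (q : ℕ) [Fact q.Prime] (e : ℕ) (t n x : ℚ_[q]) : Matrix (Fin 2) (Fin 2) ℚ_[q] :=
  !![t - x, -((x ^ 2 - t * x + n) / (q : ℚ_[q]) ^ e); (q : ℚ_[q]) ^ e, x]

/-- NEW: `A ≡ λ · 1 (mod q M₂(ℤ_q))` for some `λ` (necessarily `λ ≡ A 0 0`): the matrix is NOT optimal for the
maximal order `M₂(ℤ_q) = O₀`, the top end of the path of maximal orders containing `O`.  For `A ∈ M₂(ℤ_q)` this is
`¬ IsOptimalMat q 0 A` (H8.0). -/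
def IsScalarModQ (A : Matrix (Fin 2) (Fin 2) ℚ_[q]) : Prop :=
  ‖A 0 1‖ < 1 ∧ ‖A 1 0‖ < 1 ∧ ‖A 0 0 - A 1 1‖ < 1

end Defs

/-! ## T1 helper lemmas (H8.0–H8.12).  Sizes: XS = a few lines, S = one short prover sitting. -/

section Helpers

variable {q : ℕ} [hq : Fact q.Prime]

/-- H8.0 (XS, bridge to gen 6's currency): for an integral matrix, "scalar mod `q`" is "not optimal at level `q^0`"
(`‖c‖ < 1 ↔ ‖c‖ ≤ q⁻¹`: tree `Brandt.norm_lt_one_iff_le_inv`). -/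
theorem isScalarModQ_iff_not_isOptimalMat_zero {A : Matrix (Fin 2) (Fin 2) ℚ_[q]} (hA : ∀ i j, ‖A i j‖ ≤ 1) :
    IsScalarModQ A ↔ ¬ IsOptimalMat q 0 A := by
  sorry

/-- H8.1 (S) **(30.6.10)**: `ϖ⁻¹ N_x ϖ = (t-x, -f(x)/q^e; q^e, x)` (`ϖ⁻¹ = (0 q^{-e}; 1 0)`, `det ϖ = -q^e ≠ 0`). -/
theorem varpi_inv_mul_normMat_mul_varpi (e : ℕ) (t n x : ℚ_[q]) :
    (varpi q e)⁻¹ * normMat t n x * varpi q e = varpiConj q e t n x := by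
  sorry

/-- H8.2 (S) **the invariant**: conjugation by any `μ` with `μ, μ⁻¹` integral (in particular `μ ∈ O^×`) preserves
"scalar mod `q`": `μ⁻¹ (λ + X) μ = λ + μ⁻¹ X μ` with all entries of `X`, hence of `μ⁻¹ X μ`, of norm `< 1`
(ultrametric; take `λ = A 0 0`). No integrality of `A` needed. -/
theorem isScalarModQ_conj {A μ : Matrix (Fin 2) (Fin 2) ℚ_[q]} (hμ : ∀ i j, ‖μ i j‖ ≤ 1)
    (hμi : ∀ i j, ‖μ⁻¹ i j‖ ≤ 1) (hdet : IsUnit μ.det) (h : IsScalarModQ A) :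
    IsScalarModQ (μ⁻¹ * A * μ) := by
  sorry

/-- H8.2' (S) corollary: `IsScalarModQ` is constant on `EichConj` classes (`←` via `A = μ A' μ⁻¹`,
`Matrix.nonsing_inv_nonsing_inv`). -/
theorem isScalarModQ_iff_of_eichConj {e : ℕ} {A A' : Matrix (Fin 2) (Fin 2) ℚ_[q]} (h : EichConj q e A A') :
    IsScalarModQ A ↔ IsScalarModQ A' := by
  sorry

/-- H8.3 (XS): a normalized matrix is never scalar mod `q` (its `(0,1)` entry is `1`). -/
theorem not_isScalarModQ_normMat (t n x : ℚ_[q]) : ¬ IsScalarModQ (normMat t n x) := by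
  intro h
  have h1 := h.1
  simp [normMat] at h1

/-- H8.4 (XS): under `1 ≤ e`, `q ∣ t - 2x` and `q^{e+1} ∣ f(x)`, the `ϖ`-conjugate IS scalar mod `q`
(`‖-f(x)/q^e‖ ≤ q^{-1}`, `‖q^e‖ = q^{-e} < 1`, `(t-x) - x = t - 2x`). -/
theorem isScalarModQ_varpiConj {e : ℕ} (he : 1 ≤ e) {t n x : ℚ_[q]} (htx : ‖t - 2 * x‖ < 1)
    (hf : ‖x ^ 2 - t * x + n‖ ≤ (q : ℝ) ^ (-((e + 1 : ℕ) : ℤ))) : IsScalarModQ (varpiConj q e t n x) := by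
  sorry

/-- H8.5a (XS): `q ∣ d ⇒ q ∣ t - 2x` for a root `x` of `f` mod `q`: `(t - 2x)² = (t² - 4n) + 4 f(x)`. -/
theorem norm_sub_two_mul_lt_one {t n x : ℚ_[q]} (hd : ‖t ^ 2 - 4 * n‖ < 1) (hf : ‖x ^ 2 - t * x + n‖ < 1) :
    ‖t - 2 * x‖ < 1 := by
  sorry

/-- H8.5b (XS): `d` a unit ⇒ `t - 2x` a unit, for a root `x` of `f` mod `q` (same identity; Voight p. 544 l. 2–4). -/
theorem norm_sub_two_mul_eq_one {t n x : ℚ_[q]} (ht : ‖t‖ ≤ 1) (hx : ‖x‖ ≤ 1) (hd : ‖t ^ 2 - 4 * n‖ = 1)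
    (hf : ‖x ^ 2 - t * x + n‖ < 1) : ‖t - 2 * x‖ = 1 := by
  sorry

/-- H8.6 (S) **= L. 30.6.9 (c) ⇒, the "subtle" direction**: if `q ∣ d` and `q^{e+1} ∣ f(x)` then `ϖ⁻¹ N_x ϖ` is not
`O^×`-conjugate to ANY normalized matrix.  Proof = H8.1 + H8.4 (with H8.5a) + H8.2' + H8.3. -/
theorem not_eichConj_varpi_normMat {e : ℕ} (he : 1 ≤ e) {t n x : ℚ_[q]}
    (hd : ‖t ^ 2 - 4 * n‖ < 1) (hf : ‖x ^ 2 - t * x + n‖ ≤ (q : ℝ) ^ (-((e + 1 : ℕ) : ℤ))) (x' : ℚ_[q]) :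
    ¬ EichConj q e ((varpi q e)⁻¹ * normMat t n x * varpi q e) (normMat t n x') := by
  have hq1 : (1 : ℝ) < q := by exact_mod_cast hq.out.one_lt
  have hf1 : ‖x ^ 2 - t * x + n‖ < 1 :=
    lt_of_le_of_lt hf (zpow_lt_one_of_neg₀ hq1 (by omega))
  intro h
  rw [varpi_inv_mul_normMat_mul_varpi] at h
  exact not_isScalarModQ_normMat t n x'
    ((isScalarModQ_iff_of_eichConj h).1
      (isScalarModQ_varpiConj he (norm_sub_two_mul_lt_one hd hf1) hf))

/-- H8.7 (S) **= (30.6.5) applied to (30.6.10)**: if `f(x)/q^e` is a unit then `ϖ⁻¹ N_x ϖ ~ N_{t-x}`, witness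
`μ = diag(1, β⁻¹)`, `β = -f(x)/q^e`: `μ⁻¹ (α β; γ δ) μ = (α, 1; γβ, δ)` and `q^e · β = -f(x) = -f(t-x)`. -/
theorem eichConj_varpi_normMat_of_norm_eq {e : ℕ} {t n x : ℚ_[q]} (ht : ‖t‖ ≤ 1) (hn : ‖n‖ ≤ 1) (hx : ‖x‖ ≤ 1)
    (hf : ‖x ^ 2 - t * x + n‖ = (q : ℝ) ^ (-(e : ℤ))) :
    EichConj q e ((varpi q e)⁻¹ * normMat t n x * varpi q e) (normMat t n (t - x)) := by
  sorry

/-- H8.8 (S) **= (30.6.11)**: if `t - 2x` is a unit (⇐ `d` unit, H8.5b) then `ϖ⁻¹ N_x ϖ ~ N_{x''}` for an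
`x'' ≡ t - x (mod q^e)`; witnesses `u = (t-2x)⁻¹ (1 + f(x)/q^e)`, `μ₁ = (1 u; 0 1)` (top-right entry becomes
`1 - u² q^e`, a unit since `e ≥ 1`), then `μ₂ = diag(1, (1 - u² q^e)⁻¹)`; `x'' = t - x - u q^e`.  No Hensel. -/
theorem eichConj_varpi_normMat_of_disc_unit {e : ℕ} (he : 1 ≤ e) {t n x : ℚ_[q]} (ht : ‖t‖ ≤ 1) (hn : ‖n‖ ≤ 1)
    (hx : ‖x‖ ≤ 1) (htx : ‖t - 2 * x‖ = 1) (hf : ‖x ^ 2 - t * x + n‖ ≤ (q : ℝ) ^ (-(e : ℤ))) :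
    ∃ x'' : ℚ_[q], ‖x''‖ ≤ 1 ∧ ‖x'' - (t - x)‖ ≤ (q : ℝ) ^ (-(e : ℤ)) ∧
      EichConj q e ((varpi q e)⁻¹ * normMat t n x * varpi q e) (normMat t n x'') := by
  sorry

/-- H8.9a (XS): `EichConj` is reflexive (`μ = 1`). -/
theorem eichConj_refl (e : ℕ) (A : Matrix (Fin 2) (Fin 2) ℚ_[q]) : EichConj q e A A := by
  sorry

/-- H8.9b (S): `EichConj` is symmetric (`μ ↦ μ⁻¹`, `(μ⁻¹)⁻¹ = μ` by `Matrix.nonsing_inv_nonsing_inv`). -/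
theorem EichConj.symm {e : ℕ} {A A' : Matrix (Fin 2) (Fin 2) ℚ_[q]} (h : EichConj q e A A') : EichConj q e A' A := by
  sorry

/-- H8.9c (S): `EichConj` is transitive (`μ ↦ μ₁ μ₂`; `eichlerSet` is closed under `*`: the `(1,0)` entry of a
product is `c₁ a₂ + d₁ c₂`). -/
theorem EichConj.trans {e : ℕ} {A A' A'' : Matrix (Fin 2) (Fin 2) ℚ_[q]} (h : EichConj q e A A')
    (h' : EichConj q e A' A'') : EichConj q e A A'' := by
  sorry

/-- H8.10 (S) **= L. 30.6.9 (a) ⇒, one level down**: the diagonal entries are class functions modulo `q^e` on `O`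
(`O / q^e M₂(ℤ_q)` is upper triangular): `(μ⁻¹ A μ)₀₀ - A₀₀ = q'·c·α + p·b·γ + q'·γ·(d - a)` with
`μ⁻¹ = (p q'; r s)`, `μ = (α β; γ δ)`, where `‖c‖, ‖γ‖ ≤ q^{-e}`. -/
theorem norm_conj_apply_sub_le {e : ℕ} {A μ : Matrix (Fin 2) (Fin 2) ℚ_[q]} (hA : A ∈ eichlerSet q e)
    (hμ : μ ∈ eichlerSet q e) (hμi : μ⁻¹ ∈ eichlerSet q e) (hdet : IsUnit μ.det) :
    ‖(μ⁻¹ * A * μ) 0 0 - A 0 0‖ ≤ (q : ℝ) ^ (-(e : ℤ)) := by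
  sorry

/-- H8.11 (S) **= L. 30.6.9 (a) ⇐**: `x ≡ x' (mod q^e)` ⇒ `N_x ~ N_{x'}`, witness `μ = (1 0; x'-x 1) ∈ O^×`. -/
theorem eichConj_normMat_of_norm_sub_le {e : ℕ} {t n x x' : ℚ_[q]} (ht : ‖t‖ ≤ 1) (hn : ‖n‖ ≤ 1) (hx : ‖x‖ ≤ 1)
    (hx' : ‖x'‖ ≤ 1) (h : ‖x' - x‖ ≤ (q : ℝ) ^ (-(e : ℤ))) : EichConj q e (normMat t n x) (normMat t n x') := by
  sorry

/-- H8.12 (XS): `f(y) - f(x) = (y - x)(y + x - t)`, so `y ≡ x (mod q^e)` ⇒ `f(y) ≡ f(x) (mod q^e)`. -/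
theorem norm_f_sub_f_le {e : ℕ} {t n x y : ℚ_[q]} (ht : ‖t‖ ≤ 1) (hx : ‖x‖ ≤ 1) (hy : ‖y‖ ≤ 1)
    (h : ‖y - x‖ ≤ (q : ℝ) ^ (-(e : ℤ))) :
    ‖(y ^ 2 - t * y + n) - (x ^ 2 - t * x + n)‖ ≤ (q : ℝ) ^ (-(e : ℤ)) := by
  sorry

/-- normalized matrices lie in `O` (entries `x, 1, -f(x), t-x`; `‖f(x)‖ ≤ q^{-e}`). XS. -/
theorem normMat_mem_eichlerSet {e : ℕ} {t n x : ℚ_[q]} (ht : ‖t‖ ≤ 1) (hx : ‖x‖ ≤ 1)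
    (hfx : ‖x ^ 2 - t * x + n‖ ≤ (q : ℝ) ^ (-(e : ℤ))) : normMat t n x ∈ eichlerSet q e := by
  sorry

end Helpers

/-! ## Assemblies: gen 6's H6.A3 and H6.A4, verbatim signatures, PROVED modulo H8.* -/

section Assembly

variable {q : ℕ} [hq : Fact q.Prime]

/-- **H6.A3** [Voight L. 30.6.9(a)] from H8.10 + H8.11.  PROVED modulo the helpers. -/
theorem eichConj_normMat_iff {e : ℕ} (he : 1 ≤ e) {t n x x' : ℚ_[q]} (ht : ‖t‖ ≤ 1) (hn : ‖n‖ ≤ 1)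
    (hx : ‖x‖ ≤ 1) (hx' : ‖x'‖ ≤ 1) (hfx : ‖x ^ 2 - t * x + n‖ ≤ (q : ℝ) ^ (-(e : ℤ)))
    (hfx' : ‖x' ^ 2 - t * x' + n‖ ≤ (q : ℝ) ^ (-(e : ℤ))) :
    EichConj q e (normMat t n x) (normMat t n x') ↔ ‖x - x'‖ ≤ (q : ℝ) ^ (-(e : ℤ)) := by
  constructor
  · rintro ⟨μ, hμ, hdet, hμi, hA'⟩
    have h := norm_conj_apply_sub_le (normMat_mem_eichlerSet ht hx hfx) hμ hμi hdet
    rw [← hA'] at h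
    rw [norm_sub_rev]
    simpa [normMat] using h
  · intro h
    exact eichConj_normMat_of_norm_sub_le ht hn hx hx' (by rwa [norm_sub_rev])

/-- **H6.A4** [Voight L. 30.6.9(b)(c)] from H8.6 (new classes), H8.7/H8.8 (explicit conjugations), H8.9 (equivalence
relation), H8.12 and H6.A3.  PROVED modulo the helpers. -/
theorem eichConj_varpi_normMat_iff {e : ℕ} (he : 1 ≤ e) {t n x x' : ℚ_[q]} (ht : ‖t‖ ≤ 1) (hn : ‖n‖ ≤ 1)
    (hx : ‖x‖ ≤ 1) (hx' : ‖x'‖ ≤ 1) (hfx : ‖x ^ 2 - t * x + n‖ ≤ (q : ℝ) ^ (-(e : ℤ)))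
    (hfx' : ‖x' ^ 2 - t * x' + n‖ ≤ (q : ℝ) ^ (-(e : ℤ))) :
    EichConj q e ((varpi q e)⁻¹ * normMat t n x * varpi q e) (normMat t n x') ↔
      ‖x' - (t - x)‖ ≤ (q : ℝ) ^ (-(e : ℤ)) ∧
        (‖t ^ 2 - 4 * n‖ = 1 ∨ ¬ ‖x ^ 2 - t * x + n‖ ≤ (q : ℝ) ^ (-((e + 1 : ℕ) : ℤ))) := by
  have hq1 : (1 : ℝ) < q := by exact_mod_cast hq.out.one_lt
  have hq0 : (0 : ℝ) < q := lt_trans zero_lt_one hq1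
  -- integrality facts used repeatedly
  have hd1 : ‖t ^ 2 - 4 * n‖ ≤ 1 := by
    have h4 : ‖(4 : ℚ_[q])‖ ≤ 1 := by simpa using Padic.norm_int_le_one (p := q) 4
    refine (Brandt.norm_sub_le_max _ _).trans (max_le ?_ ?_)
    · rw [norm_pow]; exact pow_le_one₀ (norm_nonneg t) ht
    · rw [norm_mul]; exact mul_le_one₀ h4 (norm_nonneg n) hn
  have htx1 : ‖t - x‖ ≤ 1 := (Brandt.norm_sub_le_max t x).trans (max_le ht hx)
  have hftx : (t - x) ^ 2 - t * (t - x) + n = x ^ 2 - t * x + n := by ring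
  by_cases hcase : ‖t ^ 2 - 4 * n‖ = 1 ∨ ¬ ‖x ^ 2 - t * x + n‖ ≤ (q : ℝ) ^ (-((e + 1 : ℕ) : ℤ))
  · -- balanced classes: ϖ⁻¹ N_x ϖ ~ N_{x''} with x'' ≡ t - x (H8.7 / H8.8), then H6.A3
    simp only [hcase, and_true]
    obtain ⟨x'', hx''1, hx''2, hW⟩ : ∃ x'' : ℚ_[q], ‖x''‖ ≤ 1 ∧ ‖x'' - (t - x)‖ ≤ (q : ℝ) ^ (-(e : ℤ)) ∧
        EichConj q e ((varpi q e)⁻¹ * normMat t n x * varpi q e) (normMat t n x'') := by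
      rcases hcase with hd | hf
      · exact eichConj_varpi_normMat_of_disc_unit he ht hn hx
          (norm_sub_two_mul_eq_one ht hx hd (lt_of_le_of_lt hfx (zpow_lt_one_of_neg₀ hq1 (by omega)))) hfx
      · refine ⟨t - x, htx1, ?_, eichConj_varpi_normMat_of_norm_eq ht hn hx (le_antisymm hfx ?_)⟩
        · rw [sub_self, norm_zero]; exact zpow_nonneg hq0.le _
        · -- `‖f(x)‖ ≤ q^{-e}` and `¬ ‖f(x)‖ ≤ q^{-(e+1)}` force `‖f(x)‖ = q^{-e}` (the norm is a power of `q`)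
          have h := not_lt.mp
            ((Padic.norm_le_pow_iff_norm_lt_pow_add_one (x ^ 2 - t * x + n) (-((e + 1 : ℕ) : ℤ))).not.mp hf)
          have he1 : (-((e + 1 : ℕ) : ℤ)) + 1 = -(e : ℤ) := by omega
          rw [he1] at h
          exact h
    have hfx'' : ‖x'' ^ 2 - t * x'' + n‖ ≤ (q : ℝ) ^ (-(e : ℤ)) := by
      have h1 := norm_f_sub_f_le (n := n) ht htx1 hx''1 hx''2
      rw [hftx] at h1
      have hsplit : x'' ^ 2 - t * x'' + n =
          ((x'' ^ 2 - t * x'' + n) - (x ^ 2 - t * x + n)) + (x ^ 2 - t * x + n) := by ring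
      rw [hsplit]
      exact (Padic.nonarchimedean _ _).trans (max_le h1 hfx)
    have hA3 := eichConj_normMat_iff he ht hn hx''1 hx' hfx'' hfx'
    constructor
    · intro h
      have h3 : ‖x'' - x'‖ ≤ (q : ℝ) ^ (-(e : ℤ)) := hA3.1 (hW.symm.trans h)
      have hsplit : x' - (t - x) = (x'' - (t - x)) - (x'' - x') := by ring
      rw [hsplit]
      exact (Brandt.norm_sub_le_max _ _).trans (max_le hx''2 h3)
    · intro h
      refine hW.trans (hA3.2 ?_)
      have hsplit : x'' - x' = (x'' - (t - x)) - (x' - (t - x)) := by ring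
      rw [hsplit]
      exact (Brandt.norm_sub_le_max _ _).trans (max_le hx''2 h)
  · -- new classes: q ∣ d and q^{e+1} ∣ f(x): no normalized matrix in the class (H8.6), and the RHS is false
    rw [not_or, not_not] at hcase
    obtain ⟨hd, hf⟩ := hcase
    have hd' : ‖t ^ 2 - 4 * n‖ < 1 := lt_of_le_of_ne hd1 hd
    simp only [not_eichConj_varpi_normMat he hd' hf x', false_iff, not_and, not_or, not_not]
    exact fun _ => ⟨hd, hf⟩

end Assembly

/-! ## T2 kernel shadows (PROVED): the finite content of (c) ⇒ and of (30.6.5) -/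

/-- (c) ⇒ at `q = 2, e = 1, f = X² + 4, x = 0` (new class): modulo `4`, `N_0 ≡ (0 1; 0 0)`, `ϖ⁻¹N_0ϖ = (0 -2; 2 0)`;
no `μ = (a b; c d)` with `c ∈ 2ℤ/4ℤ` and odd determinant satisfies `μ N_0 ≡ (ϖ⁻¹N_0ϖ) μ (mod 4)`
(`μ N_0 = (0 a; 0 c)`, `(ϖ⁻¹N_0ϖ) μ = (2c 2d; 2a 2b)` forces `a = 2d` even).  PROVED by `decide`. -/
example : ∀ a b c d : ZMod 4, (c = 0 ∨ c = 2) → (a * d - b * c = 1 ∨ a * d - b * c = 3) →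
    ¬ ((0 : ZMod 4) = 2 * c ∧ a = 2 * d ∧ (0 : ZMod 4) = 2 * a ∧ c = 2 * b) := by
  decide

/-- (30.6.5)/(H8.7) at `q = 2, e = 1, f = X² - X + 2` (`d = -7` a unit), `x = 0`: `μ = diag(1, -1)` conjugates
`ϖ⁻¹ N_0 ϖ = (1 -1; 2 0)` to `N_1 = (1 1; -2 0)`, i.e. `μ N_1 = (ϖ⁻¹N_0ϖ) μ` over `ℤ`.  PROVED. -/
example : !![(1 : ℤ), 0; 0, -1] * !![1, 1; -2, 0] = !![1, -1; 2, 0] * !![(1 : ℤ), 0; 0, -1] := by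
  decide

/-- Degenerate parameter `e = 0` (T2(iii)): `ϖ = (0 1; 1 0)` is then a unit of `O = M₂`, so `ϖ⁻¹ N_x ϖ ~ N_x` always,
while the typed right-hand side of H6.A4 can fail (`q = 2`, `f = X² + 4`, `x = x' = 0`: `2 ∣ d`, `2 ∣ f(0)`):
`he : 1 ≤ e` is load-bearing.  Finite content: `ϖ N_0 ϖ⁻¹... ` here just `det ϖ = -1`.  PROVED. -/
example : Matrix.det !![(0 : ℤ), 1; 1, 0] = -1 := by
  decide

end Summit.ABC.ABC.Cruxes.DefiniteRTControlPrime.StubIdeas3g8
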